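import Summits.FinalStateConjecture.FinalStateConjecture.Theorems.PhotonSphereChannelsChannelsResolveTameDevelopmentsRHullRigidGivenSEK
import Summits.FinalStateConjecture.FinalStateConjecture.Theorems.PhotonSphereChannelsChannelsResolveTameDevelopmentsRDockTransfer
import HarnessLib

/-!
# Route PhotonSphereChannels · crux `ChannelsResolveTameDevelopmentsR` (K2R-T2, stmt-FinalStateConjecture-17430) ·
# line `tame-lasalle-dock` · stub R: the transfer through a DOCK-READY REPRESENTATIVE

Stub R (`stub_hullRigidGivenSEK`) transfers SEK (rigidity of silent eternal vacua, docked onto route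
EternalPapapetrou's items stmt-10034 / stmt-10745) to the hull elements of a tame development. The end-level
transfer `TameLaSalle.isMinkowski_or_exists_isKerrDoc_of_silentEternalIsKerr` (`…RHullRigidGivenSEK.lean`) needs
the spacetime to be GLOBALLY HYPERBOLIC and black-hole-or-complete w.r.t. the end, which an arbitrary hull element
is not (no covering clause: trimming inside the black-hole region). This file proves the transfer in the honest
REPRESENTATIVE form, which is the shape of the reshaped stub `stub_dockReadyHull` of the skeleton
(`Cruxes/ChannelsResolveTameDevelopmentsR/Lines/tame_lasalle_dock.lean`, Reshape 1 of lead c8):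

* `isMinkowski_or_isKerrDoc_of_dockReady` — SEK + a silent end `E` of `𝓢` in an all-orders class + DOCK-READINESS
  (either `𝓢` itself is globally hyperbolic and timelike+null complete, or there is a globally hyperbolic,
  black-hole-or-complete REPRESENTATIVE `(𝓢', E')`, again a silent end in some all-orders class, with an
  orientation-preserving injective local isometry `j : 𝓢' → 𝓢` carrying its d.o.c. onto `E.doc` and flatness of `𝓢'`
  onto flatness of `𝓢`) + NO EXTREMAL SHADOW (every Kerr exterior locally isometric onto `E.doc` is sub-extremal)
  ⇒ `𝓢` is Minkowski or `E.doc` is EXACTLY a sub-extremal Kerr exterior. The representative is classified by the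
  end-level transfer (its own sub-extremality test is pulled back to `𝓢` by `kerrExteriorUpToOrientation_image`) and
  the verdict is pushed forward along `j` (`isKerrDoc_image_of_isLocalIsometry`).

No route item is restated: SEK is a hypothesis, the conclusion is R's per-element conclusion.

References: O'Neill 1983, Ch. 3, pp. 90–91 [ONeill1983]; Wald 1984, §12.1 [Wald1984]; Dafermos–Luk 2017,
Conjecture 1 [DafermosLuk2017].
-/

noncomputable section

-- the operator-norm instance on `E4 →L[ℝ] E4 →L[ℝ] ℝ` needs one more level of pending
-- instance problems than the default (as in `PhotonSphereChannelsTameHullDefs.lean`)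
set_option maxSynthPendingDepth 3
-- every `Summit.FinalStateConjecture.FinalStateConjecture.…` name repeats the summit = sub-problem segment (D-0017 layout)
set_option linter.dupNamespace false

open Set Filter Function TopologicalSpace Manifold Bundle
open scoped Topology Manifold ContDiff ENNReal NNReal

namespace Summit.FinalStateConjecture.FinalStateConjecture.Theorems.TameLaSalle

open Literature.Geometry.Lorentzian
open Summit.FinalStateConjecture.FinalStateConjecture.Theorems.TameHull
open Summit.FinalStateConjecture.FinalStateConjecture.Theorems.DarkFuture

/-- **The transfer through a dock-ready representative (stub R of line `tame-lasalle-dock`, per element;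
registered sub-goal `isMinkowski_or_isKerrDoc_of_dockReady` of stmt-FinalStateConjecture-17430).** Hypotheses:
SEK verbatim (names of `Literature.Geometry.Lorentzian` shortened); a silent end `E` of `𝓢` in an all-orders class;
DOCK-READINESS — `𝓢` itself globally hyperbolic and timelike- and null-geodesically complete, OR a representative
`(𝓢', E', j)`: `E'` a silent end of `𝓢'` in some all-orders class, `𝓢'` globally hyperbolic and black-hole w.r.t.
`E'` or complete, `j : 𝓢' → 𝓢` an injective local isometry whose differential preserves future-directedness, with
`j '' E'.doc = E.doc` and `IsMinkowski 𝓢' → IsMinkowski 𝓢`; NO EXTREMAL SHADOW for `E.doc` in `𝓢`. Conclusion: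
`IsMinkowski 𝓢 ∨ ∃ M a, 0 < M ∧ |a| < M ∧ IsKerrDoc 𝓢 E.doc M a`. [cite: DafermosLuk2017, Conjecture 1] -/
theorem isMinkowski_or_isKerrDoc_of_dockReady : ∀ [Kerr.Facts], (∀ (M R : ℝ) (C : ℕ → ℝ), 0 ≤ M → max (2 * M) 0 < R → ∀ (𝓢 : Spacetime.{0} 4) [𝓢.metric.toPseudoRiemannianMetric.HasLeviCivita] [Kerr.Facts], 𝓢.metric.toPseudoRiemannianMetric.IsRicciFlat → 𝓢.metric.IsGloballyHyperbolic 𝓢.timeOrientation → ∀ (Φ : Kerr.region (0 : ℝ) R → 𝓢.carrier), IsLocalDiffeomorph 𝓘(ℝ, E4) (𝓡 4) (⊤ : ℕ∞) Φ → Function.Injective Φ → let B : ModelBackground := ⟨Kerr.region 0 R, Kerr.bilin M 0, fun x ↦ x 0, Kerr.radius 0⟩; let h : E4 → E4 →L[ℝ] E4 →L[ℝ] ℝ := 𝓢.deviationExtend B Φ; let hₜ : E4 → E4 →L[ℝ] E4 →L[ℝ] ℝ := fun y ↦ fderiv ℝ h y (E4.basisVector 0); (∀ (m : ℕ) (x :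 Kerr.region (0 : ℝ) R), ‖iteratedFDeriv ℝ m h x.1‖ * Kerr.radius 0 x.1 ≤ C m) → (∀ (m : ℕ), ∀ δ > (0 : ℝ), ∃ R' : ℝ, ∀ x : Kerr.region (0 : ℝ) R, R' < Kerr.radius 0 x.1 → ‖iteratedFDeriv ℝ m hₜ x.1‖ * Kerr.radius 0 x.1 ≤ δ) → ((𝓢.blackHoleRegionOfEnd (Set.range Φ)).Nonempty ∨ (𝓢.metric.IsTimelikeGeodesicallyComplete ∧ 𝓢.metric.IsNullGeodesicallyComplete)) → (∃ (M' a : ℝ), 0 < M' ∧ |a| ≤ M' ∧ ∃ Ψ : Kerr.exterior M' a → 𝓢.carrier, Function.Injective Ψ ∧ Set.range Ψ = 𝓢.docOfEnd (Set.range Φ) ∧ PseudoRiemannianMetric.IsLocalIsometry (Kerr.smoothMetric M' a (Kerr.rPlus M' a)).toPseudoRiemannianMetric 𝓢.metric.toPseudoRiemannianMetric Ψ) ∨ (∃ Ψ : Diffeomorph (𝓡 4) 𝓘(ℝ, E4) 𝓢.carrier E4 (⊤ : ℕ∞), PseudoRiemannianMetric.IsIsometry 𝓢.metric.toPseudoRiemannianMetric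 (Minkowski.metric.ofLE le_top : LorentzianMetric 𝓘(ℝ, E4) (⊤ : ℕ∞) E4).toPseudoRiemannianMetric Ψ)) → ∀ {𝓢 : Spacetime.{0} 4} [𝓢.metric.HasLeviCivita] (E : EndDatum 𝓢) {Λ : ℕ → ℝ≥0} {r₀ : ℝ}, IsTameClass E Λ r₀ → E.IsSilent → ((𝓢.metric.IsGloballyHyperbolic 𝓢.timeOrientation ∧ 𝓢.metric.IsTimelikeGeodesicallyComplete ∧ 𝓢.metric.IsNullGeodesicallyComplete) ∨ (∃ (𝓢' : Spacetime.{0} 4) (E' : EndDatum 𝓢') (Λ' : ℕ → ℝ≥0) (r₀' : ℝ) (j : 𝓢'.carrier → 𝓢.carrier), IsTameClass E' Λ' r₀' ∧ E'.IsSilent ∧ (∀ [𝓢'.metric.HasLeviCivita], 𝓢'.metric.IsGloballyHyperbolic 𝓢'.timeOrientation ∧ ((𝓢'.blackHoleRegionOfEnd (Set.range E'.far)).Nonempty ∨ (𝓢'.metric.IsTimelikeGeodesicallyComplete ∧ 𝓢'.metric.IsNullGeodesicallyComplete))) ∧ Function.Injective j ∧ PseudoRiemannianMetric.IsLocalIsometry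 𝓢'.metric.toPseudoRiemannianMetric 𝓢.metric.toPseudoRiemannianMetric j ∧ (∀ (x : 𝓢'.carrier) (v : TangentSpace (𝓡 4) x), 𝓢'.timeOrientation.IsFutureDirected v → 𝓢.timeOrientation.IsFutureDirected (mfderiv (𝓡 4) (𝓡 4) j x v)) ∧ j '' E'.doc = E.doc ∧ (IsMinkowski 𝓢' → IsMinkowski 𝓢))) → (∀ M' a : ℝ, 0 < M' → |a| ≤ M' → (∃ Ψ : Kerr.exterior M' a → 𝓢.carrier, Function.Injective Ψ ∧ Set.range Ψ = E.doc ∧ PseudoRiemannianMetric.IsLocalIsometry (Kerr.smoothMetric M' a (Kerr.rPlus M' a)).toPseudoRiemannianMetric 𝓢.metric.toPseudoRiemannianMetric Ψ) → |a| < M') → (IsMinkowski 𝓢 ∨ ∃ M a : ℝ, 0 < M ∧ |a| < M ∧ IsKerrDoc 𝓢 E.doc M a) := by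
  intro _ hSEK 𝓢 _ E Λ r₀ hcls hsil hready hsub
  rcases hready with ⟨hGH, htc, hnc⟩ | ⟨𝓢', E', Λ', r₀', j, hcls', hsil', hGH', hj, hiso, hfut, hdoc, hmink⟩
  · -- Case B: the element itself is globally hyperbolic and complete
    exact isMinkowski_or_exists_isKerrDoc_of_silentEternalIsKerr hSEK E hcls hsil hGH (Or.inr ⟨htc, hnc⟩) hsub
  · -- Case A: classify the representative, push the verdict forward along `j`
    haveI : 𝓢'.metric.HasLeviCivita := 𝓢'.metric.toPseudoRiemannianMetric.hasLeviCivita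
    obtain ⟨hGH₁, hbh₁⟩ := hGH'
    -- the representative's sub-extremality test is run in `𝓢` (push U's conclusion shape forward)
    have hsub' : ∀ M' a : ℝ, 0 < M' → |a| ≤ M' →
        (∃ Ψ : Kerr.exterior M' a → 𝓢'.carrier, Function.Injective Ψ ∧ Set.range Ψ = E'.doc ∧
          PseudoRiemannianMetric.IsLocalIsometry
            (Kerr.smoothMetric M' a (Kerr.rPlus M' a)).toPseudoRiemannianMetric
            𝓢'.metric.toPseudoRiemannianMetric Ψ) → |a| < M' := by
      intro M' a hM' ha h
      refine hsub M' a hM' ha ?_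
      rw [← hdoc]
      exact kerrExteriorUpToOrientation_image hj hiso h
    rcases isMinkowski_or_exists_isKerrDoc_of_silentEternalIsKerr hSEK E' hcls' hsil' hGH₁ hbh₁ hsub' with
      hflat | ⟨M, a, hM, ha, hkerr⟩
    · exact Or.inl (hmink hflat)
    · refine Or.inr ⟨M, a, hM, ha, ?_⟩
      rw [← hdoc]
      exact isKerrDoc_image_of_isLocalIsometry j E'.doc M a hj hiso hfut hkerr

end Summit.FinalStateConjecture.FinalStateConjecture.Theorems.TameLaSalle

end
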